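import Literature.MathematicalPhysics.QuantumFieldTheory.Balaban1983to89.BalabanAdmissibleClassParams
import Literature.MathematicalPhysics.QuantumFieldTheory.Balaban1983to89.T3Thresholds
import HarnessLib

/-!
# Crux `BackwardStabilityAdmFR` (stmt-QuantumFields-28294), frame analysis: THE TYPED CLASS IS INSENSITIVE TO BOUNDED MULTIPLICATIVE
# PERTURBATIONS (companion of `…AdmFRFrameInhabited` ∕ `…FloorTail` ∕ `…EmptyClass` ∕ `…TopHeight`; unit ym-blr-lyapunov-reader-1, R625-ym (P1) reader)

WHAT IS PROVED (bookkeeping on the typed clauses of `BalabanUVClass.Witness`, no analysis).  If `r` has a class witness for the parameters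
`prm` and `p` is ANY measurable, gauge-invariant function with `|p| ≤ S`, then `r·e^{p}` has a class witness for every weaker parameter set
`prm'` whose vacuum-energy budget and stability constant are enlarged by `O(S)`: `cE + S ≤ cE'` and `c5·|T| + S + cLF' ≤ c5'·|T|`
(`|T|` = number of sites) — §1 `mem_mul_exp`.  The witness is EXPLICIT: same background, same localisation domains and activities,
`cst ↦ cst − S` (the constant has the VOLUME budget `|cst| ≤ cE·|T|`, (65) p.273), and the large-field part `lf ↦` THE WHOLE DENSITY (its typed
budget is `e^{−cLF}·e^{c5·|T|}`, which at every height exceeds the density's own bound `e^{c5·|T|}` of (5) once `c5` absorbs `(S + cLF')∕|T|`).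
§2 lifts this to the height reading `MemAtHeight F ℰ j` of the route's frame, and §3 shows that along an ADMISSIBLE schedule the enlarged
schedule is again admissible (`cLF' := p(g_j)²∕4`, the printed minimum, and `p(g_j)²∕4 ≤ (R²∕4γ)·|T_j|` from the tree's uniform threshold bound
`T3Thresholds.θBal_le_const_mul_rpow`), so that: **for every admissible `prm` there is an admissible `prm'` such that every `∃κ`-member at
every height stays an `∃κ`-member after multiplication by any `e^{p}`, `|p| ≤ S`, `p` measurable and gauge invariant** (§3
`exists_admissible_soft`).

WHY IT MATTERS FOR 28294 (honest census of the frame; reader memo `Cruxes/BackwardStabilityAdmFR/READER-MEMO-currencies-reader1-g0.md` §C5).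
The upper half of the two-sided representation (41) and the footprint∕activity clauses do NOT constrain a member beyond `r ≤ e^{c5|T|}`: AS
TYPED, membership pins the LOWER Gibbs bound on the window, the global bound (5), the large-plaquette suppression (71), positivity,
measurability, gauge invariance and the existence of the background map — nothing else.  Consequently the hypothesis of the crux that
excludes «soft» consistent perturbations of a class tower (bumps attached at coarse heights and pulled back, which would otherwise refute the
conclusion) is NOT membership but the κ-CLUSTERED FOUR-POINT clause at every height (a pull-back through `n` averaging steps has range `~Lⁿ`).
This corrects the g13 card's «upward inadmissibility via footprints» (not enforced as typed) without touching the crux.  Nothing of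
28294 ∕ 28295 ∕ 28296 is proved or refuted; rung R3 (`YM3TorusSU2`, finite-volume SU(2) YM₃ on T³ — not d = 4, not infinite volume, not a mass gap,
not Clay) and every summit statement stay OPEN; the Yang–Mills mass gap is NOT proved.
-/

namespace Summit.QuantumFields.YangMills.Theorems.AdmFRFrameSoftPerturbation

open MeasureTheory
open Literature.MathematicalPhysics.QuantumFieldTheory.Balaban1983to89 T3ContinuumYM3Torus T3LevelShift T3UnitScaleTilt BalabanUVClass

/-! ## §1 One level of one run: a witness for `r` gives a witness for `r·e^{p}`, `|p| ≤ S` -/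

section Generic

variable {P : Params} {k : ℕ} {G : Type*} [GaugeGroup G] [MeasurableSpace G]

/-- **THE TYPED CLASS IS INSENSITIVE TO BOUNDED MULTIPLICATIVE PERTURBATIONS** (one level of one run, any averaging family): from a witness of
`r` for `prm`, a witness of `V ↦ r V · exp (p V)` for `prm'` — `p` measurable, gauge invariant, `|p| ≤ S`, `0 ≤ S`; `prm'` weaker than `prm` with
`cE + S ≤ cE'`, `0 ≤ cLF'`, `c5·|T| + S + cLF' ≤ c5'·|T|`.  Witness: same background ∕ domains ∕ activities, `cst − S`, `lf :=` the density itself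
(the upper half of (41) is then void, its budget `e^{−cLF'}e^{c5'|T|}` being met by (5)). [cite: Balaban1985UV3, (5) p.256, (41)-(47) pp.266-267, (65) p.273] -/
theorem mem_mul_exp {av : (i : ℕ) → Averaging P i G} {prm prm' : ClassParams} {r p : GaugeField P k G → ℝ} {S : ℝ}
    (h : Mem av prm r) (hw : prm.Weaker prm') (hS : 0 ≤ S) (hp : ∀ V, |p V| ≤ S) (hpm : Measurable p)
    (hpg : GaugeField.GaugeInvariant p) (hcE : prm.cE + S ≤ prm'.cE) (hcLF : 0 ≤ prm'.cLF)
    (hc5 : prm.c5 * Fintype.card (Site P k) + S + prm'.cLF ≤ prm'.c5 * Fintype.card (Site P k)) :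
    Mem av prm' (fun V => r V * Real.exp (p V)) := by
  classical
  obtain ⟨W⟩ := h
  -- the global bound (5) for `r`, and its consequence for `r·e^p`
  have h5 : ∀ V, r V * Real.exp (p V) ≤ Real.exp (prm.c5 * Fintype.card (Site P k) + S) := fun V => by
    rw [Real.exp_add]
    exact mul_le_mul (W.bounds5_upper V) (Real.exp_le_exp.mpr ((le_abs_self _).trans (hp V))) (Real.exp_nonneg _)
      (Real.exp_nonneg _)
  have hn1 : (1 : ℝ) ≤ Fintype.card (Site P k) := by
    exact_mod_cast Fintype.card_pos (α := Site P k)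
  refine ⟨{
    bg := W.bg
    nDom := W.nDom
    supp := W.supp
    foot := W.foot
    len := W.len
    wt := W.wt
    act := W.act
    cst := W.cst - S
    lf := fun V => r V * Real.exp (p V)
    nonneg := fun V => mul_nonneg (W.nonneg V) (Real.exp_nonneg _)
    measurable := W.measurable.mul (Real.measurable_exp.comp hpm)
    gaugeInvariant := fun u U => by
      show r (GaugeField.gaugeAct u U) * Real.exp (p (GaugeField.gaugeAct u U)) = r U * Real.exp (p U)
      rw [W.gaugeInvariant u U, hpg u U]
    isBackground := fun V hV => by
      rw [hw.δreg_eq]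
      exact W.isBackground V fun q => (hV q).trans_le hw.δ_le
    foot_nonempty := W.foot_nonempty
    supp_foot := W.supp_foot
    len_nonneg := W.len_nonneg
    wt_nonneg := W.wt_nonneg
    diam_foot := fun X y hy y' hy' =>
      (W.diam_foot X y hy y' hy').trans (mul_le_mul_of_nonneg_right hw.M_le (by linarith [W.len_nonneg X]))
    act_local := W.act_local
    act_gaugeInvariant := W.act_gaugeInvariant
    act_bound := fun X V hV => by
      rw [hw.κ_eq]
      exact W.act_bound X V fun q => (hV q).trans_le hw.δ_le
    cover := fun y => by
      rw [hw.κ_eq]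
      exact (W.cover y).trans hw.Ccov_le
    cst_abs_le := by
      have h1 := W.cst_abs_le
      have h2 : |W.cst - S| ≤ |W.cst| + S := by
        rw [sub_eq_add_neg]
        exact (abs_add_le _ _).trans (by rw [abs_neg, abs_of_nonneg hS])
      have h3 : prm.cE * Fintype.card (Site P k) + S ≤ prm'.cE * Fintype.card (Site P k) := by
        have : S ≤ S * Fintype.card (Site P k) := le_mul_of_one_le_right hS hn1
        nlinarith [hcE, this]
      linarith
    lower := fun V hV => by
      have hV' : PlaqSmall prm.δ V := fun q => (hV q).trans_le hw.δ_le
      have hl := W.lower V hV'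
      have hlow : Real.exp (-S) ≤ Real.exp (p V) := Real.exp_le_exp.mpr (by linarith [neg_abs_le (p V), hp V])
      rw [hw.β_eq]
      calc Real.exp (-(prm.β * wilsonAction4 (W.bg V)) + (∑ X, W.act X (W.bg V)) + (W.cst - S) - prm'.slack)
          ≤ Real.exp ((-(prm.β * wilsonAction4 (W.bg V)) + (∑ X, W.act X (W.bg V)) + W.cst - prm.slack) + (-S)) :=
            Real.exp_le_exp.mpr (by linarith [hw.slack_le])
        _ = Real.exp (-(prm.β * wilsonAction4 (W.bg V)) + (∑ X, W.act X (W.bg V)) + W.cst - prm.slack) * Real.exp (-S) :=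
            Real.exp_add _ _
        _ ≤ r V * Real.exp (p V) := mul_le_mul hl hlow (Real.exp_nonneg _) (W.nonneg V)
    upper := fun V _ => le_add_of_nonneg_left (Real.exp_nonneg _)
    lf_nonneg := fun V => mul_nonneg (W.nonneg V) (Real.exp_nonneg _)
    lf_le := fun V => by
      refine (h5 V).trans ?_
      rw [← Real.exp_add]
      exact Real.exp_le_exp.mpr (by linarith)
    large := fun V T hT => by
      have hl := W.large V T fun q hq => hw.δL_le.trans (hT q hq)
      have hcard : (0 : ℝ) ≤ T.card := Nat.cast_nonneg _
      calc r V * Real.exp (p V)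
          ≤ Real.exp (-(prm.cLF * T.card)) * Real.exp (prm.c5 * Fintype.card (Site P k)) * Real.exp S := by
            refine mul_le_mul hl (Real.exp_le_exp.mpr ((le_abs_self _).trans (hp V))) (Real.exp_nonneg _) ?_
            exact mul_nonneg (Real.exp_nonneg _) (Real.exp_nonneg _)
        _ = Real.exp (-(prm.cLF * T.card) + (prm.c5 * Fintype.card (Site P k) + S)) := by
            rw [← Real.exp_add, ← Real.exp_add, add_assoc]
        _ ≤ Real.exp (-(prm'.cLF * T.card) + prm'.c5 * Fintype.card (Site P k)) := by
            refine Real.exp_le_exp.mpr (add_le_add ?_ (by linarith))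
            exact neg_le_neg (mul_le_mul_of_nonneg_right hw.cLF_le hcard)
        _ = Real.exp (-(prm'.cLF * T.card)) * Real.exp (prm'.c5 * Fintype.card (Site P k)) := Real.exp_add _ _ }⟩

end Generic

/-! ## §2 The height reading of the route's frame (`MemAtHeight F ℰ j`) -/

section Height

variable (F : T3Family) {G : Type*} [GaugeGroup G] [MeasurableSpace G]

omit [MeasurableSpace G] in
/-- Gauge invariance is transported along the level identification `readAtLevel`. [cite: Balaban1985Averaging, (12) p.19] -/
theorem gaugeInvariant_readAtLevel {j K : ℕ} (hK : j ≤ K) {p : GaugeField (F.P j) 0 G → ℝ} (hpg : GaugeField.GaugeInvariant p) :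
    GaugeField.GaugeInvariant (readAtLevel F hK p) := by
  intro u W
  rw [readAtLevel_apply, readAtLevel_apply]
  exact (congrArg p (fieldShift_gaugeAct (heightShift_eq F hK) u W)).trans (hpg _ _)

/-- **HEIGHT VERSION**: a height-`j` member stays a member (for the enlarged parameters) after multiplication by `e^{p}`, `|p| ≤ S`, `p`
measurable and gauge invariant — the enlargement asked at the site count `|T_j| = (2L^{m+j})³` of the height-`j` lattice (the same on every
witness run `K ≥ j`). [cite: Balaban1985UV3, (41)-(47) pp.266-267] -/
theorem memAtHeight_mul_exp {ℰ : LoopAverage G} {j : ℕ} {prm prm' : ClassParams} {r p : GaugeField (F.P j) 0 G → ℝ} {S : ℝ}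
    (h : MemAtHeight F ℰ j prm r) (hw : prm.Weaker prm') (hS : 0 ≤ S) (hp : ∀ V, |p V| ≤ S) (hpm : Measurable p)
    (hpg : GaugeField.GaugeInvariant p) (hcE : prm.cE + S ≤ prm'.cE) (hcLF : 0 ≤ prm'.cLF)
    (hc5 : ∀ K : ℕ, j ≤ K →
      prm.c5 * Fintype.card (Site (F.P K) (K - j)) + S + prm'.cLF ≤ prm'.c5 * Fintype.card (Site (F.P K) (K - j))) :
    MemAtHeight F ℰ j prm' (fun V => r V * Real.exp (p V)) := by
  obtain ⟨K, hK, hm⟩ := h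
  refine ⟨K, hK, ?_⟩
  have key := mem_mul_exp (p := readAtLevel F hK p) hm hw hS (fun W => hp _) (measurable_readAtLevel F hK hpm)
    (gaugeInvariant_readAtLevel F hK hpg) hcE hcLF (hc5 K hK)
  exact key

end Height

/-! ## §3 Along an admissible schedule the enlarged schedule is admissible -/

section Schedule

variable (F : T3Family)

/-- The site count of the height-`j` lattice read on run `K ≥ j` dominates `L^j`: `|T| = (2L^{m+j})³ ≥ L^j`. [cite: Balaban1985UV3, (1)-(3) p.256] -/
theorem pow_le_card_site {j K : ℕ} (hK : j ≤ K) : (F.L : ℝ) ^ j ≤ Fintype.card (Site (F.P K) (K - j)) := by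
  have hcard : Fintype.card (Site (F.P K) (K - j)) = (2 * F.L ^ (F.m + K - (K - j))) ^ 3 := by
    show Fintype.card (Fin (F.P K).d → ZMod ((F.P K).sitesPerDir (K - j))) = _
    rw [Fintype.card_fun, ZMod.card, Fintype.card_fin]
    rfl
  have hexp : F.m + K - (K - j) = F.m + j := by omega
  rw [hcard, hexp]
  have hL : (1 : ℝ) ≤ F.L := by exact_mod_cast F.hL.2.le
  have h1 : (F.L : ℝ) ^ j ≤ 2 * (F.L : ℝ) ^ (F.m + j) := by
    calc (F.L : ℝ) ^ j ≤ (F.L : ℝ) ^ (F.m + j) := pow_le_pow_right₀ hL (by omega)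
      _ ≤ 2 * (F.L : ℝ) ^ (F.m + j) := by linarith [pow_nonneg (zero_le_one.trans hL) (F.m + j)]
  have h2 : (1 : ℝ) ≤ 2 * (F.L : ℝ) ^ (F.m + j) := by
    have := one_le_pow₀ (M₀ := ℝ) hL (n := F.m + j); linarith
  calc (F.L : ℝ) ^ j ≤ 2 * (F.L : ℝ) ^ (F.m + j) := h1
    _ ≤ (2 * (F.L : ℝ) ^ (F.m + j)) ^ 3 := by
        have := le_self_pow₀ h2 (by norm_num : (3 : ℕ) ≠ 0); simpa using this
    _ = ((2 * F.L ^ (F.m + j)) ^ 3 : ℕ) := by push_cast; ring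

/-- **THE PRINTED LARGE-FIELD EXPONENT IS DOMINATED BY THE VOLUME**: `p(g_j)²∕4 ≤ (R²∕(4γ))·L^j` with the tree's uniform threshold bound
`θBal_j ≤ R` (`0 < γ ≤ 1`, `0 ≤ b₀`, `0 < p₀`; `p(g_j) = θBal_j ∕ g_j`, `g_j² = γL^{-j}`). [cite: Balaban1985UV3, (7) p.257, (71) p.273] -/
theorem pFun_sq_div_four_le {γ b₀ p₀ : ℝ} (hγ : 0 < γ) (hγ1 : γ ≤ 1) (hb₀ : 0 ≤ b₀) (hp₀ : 0 < p₀) (j : ℕ) :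
    B10.pFun b₀ p₀ (Real.sqrt (γ * ((F.L : ℝ)⁻¹) ^ j)) ^ 2 / 4 ≤
      (b₀ * ((2 * p₀) ^ p₀ * Real.exp (1 / 2 - p₀)) * Real.sqrt (Real.sqrt γ)) ^ 2 / (4 * γ) * (F.L : ℝ) ^ j := by
  set R : ℝ := b₀ * ((2 * p₀) ^ p₀ * Real.exp (1 / 2 - p₀)) * Real.sqrt (Real.sqrt γ) with hR
  set g : ℝ := Real.sqrt (γ * ((F.L : ℝ)⁻¹) ^ j) with hg
  have hL : (0 : ℝ) < F.L := by exact_mod_cast lt_trans zero_lt_one F.hL.2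
  have hLj : (0 : ℝ) < (F.L : ℝ) ^ j := pow_pos hL j
  have hg2 : g ^ 2 = γ * ((F.L : ℝ)⁻¹) ^ j := by
    rw [hg, Real.sq_sqrt (mul_nonneg hγ.le (pow_nonneg (inv_nonneg.mpr hL.le) j))]
  have hgpos : 0 < g := by
    rw [hg]; exact Real.sqrt_pos.mpr (mul_pos hγ (pow_pos (inv_pos.mpr hL) j))
  have hθ : g * B10.pFun b₀ p₀ g ≤ R := by
    have h := T3Thresholds.θBal_le_const_mul_rpow (L := F.L) F.hL.2.le hγ hγ1 hb₀ hp₀ j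
    have : θBal F.L γ b₀ p₀ j = g * B10.pFun b₀ p₀ g := rfl
    rw [this] at h; rw [hR]; exact h
  have hg1 : g ≤ 1 := by rw [hg]; exact T3Thresholds.coupling_le_one F.hL.2.le hγ hγ1 j
  have hθnn : 0 ≤ g * B10.pFun b₀ p₀ g := mul_nonneg hgpos.le (B10.pFun_nonneg b₀ p₀ g hb₀ hgpos hg1)
  -- `p² = (g p)² / g² ≤ R² / g² = R² L^j / γ`
  have hsq : (g * B10.pFun b₀ p₀ g) ^ 2 ≤ R ^ 2 := pow_le_pow_left₀ hθnn hθ 2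
  have hp2 : B10.pFun b₀ p₀ g ^ 2 = (g * B10.pFun b₀ p₀ g) ^ 2 / g ^ 2 := by
    field_simp
  have hginv : 1 / g ^ 2 = (F.L : ℝ) ^ j / γ := by
    rw [hg2, inv_pow]; field_simp
  calc B10.pFun b₀ p₀ g ^ 2 / 4 = (g * B10.pFun b₀ p₀ g) ^ 2 * (1 / g ^ 2) / 4 := by rw [hp2]; ring
    _ ≤ R ^ 2 * (1 / g ^ 2) / 4 := by gcongr
    _ = R ^ 2 / (4 * γ) * (F.L : ℝ) ^ j := by rw [hginv]; ring

/-- **FOR EVERY ADMISSIBLE SCHEDULE THERE IS AN ADMISSIBLE «SOFTENED» SCHEDULE** absorbing all bounded multiplicative perturbations of size `S`: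
`prm' j` = `prm j` with `cE + S`, `cLF := p(g_j)²∕4` (the printed minimum) and `c5 + S + R²∕(4γ)`; it is weaker than `prm j`, admissible, and
meets the hypotheses of `memAtHeight_mul_exp` at every height. (`0 < γ ≤ 1`, `0 ≤ b₀`, `0 < p₀`, `0 ≤ S`.) [cite: Balaban1985UV3, (5) p.256, (65)-(71) p.273] -/
theorem exists_admissible_soft {γ b₀ p₀ : ℝ} (hγ : 0 < γ) (hγ1 : γ ≤ 1) (hb₀ : 0 ≤ b₀) (hp₀ : 0 < p₀) {prm : ℕ → ClassParams}
    (hadm : AdmissibleClassParams F γ b₀ p₀ prm) {S : ℝ} (hS : 0 ≤ S) :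
    ∃ prm' : ℕ → ClassParams, AdmissibleClassParams F γ b₀ p₀ prm' ∧ ∀ j : ℕ, (prm j).Weaker (prm' j) ∧
      (prm j).cE + S ≤ (prm' j).cE ∧ 0 ≤ (prm' j).cLF ∧
      ∀ K : ℕ, j ≤ K → (prm j).c5 * Fintype.card (Site (F.P K) (K - j)) + S + (prm' j).cLF ≤
        (prm' j).c5 * Fintype.card (Site (F.P K) (K - j)) := by
  set R : ℝ := b₀ * ((2 * p₀) ^ p₀ * Real.exp (1 / 2 - p₀)) * Real.sqrt (Real.sqrt γ) with hR
  set c : ℝ := R ^ 2 / (4 * γ) with hc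
  have hc0 : 0 ≤ c := by rw [hc]; positivity
  -- the softened schedule, field order `δ δreg δL β κ M Ccov cE slack cLF c5`
  let prm' : ℕ → ClassParams := fun j =>
    ⟨(prm j).δ, (prm j).δreg, (prm j).δL, (prm j).β, (prm j).κ, (prm j).M, (prm j).Ccov, (prm j).cE + S, (prm j).slack,
      B10.pFun b₀ p₀ (Real.sqrt (γ * ((F.L : ℝ)⁻¹) ^ j)) ^ 2 / 4, (prm j).c5 + S + c⟩
  have hcLF' : ∀ j, (prm' j).cLF = B10.pFun b₀ p₀ (Real.sqrt (γ * ((F.L : ℝ)⁻¹) ^ j)) ^ 2 / 4 := fun j => rfl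
  have hcE' : ∀ j, (prm' j).cE = (prm j).cE + S := fun j => rfl
  have hc5' : ∀ j, (prm' j).c5 = (prm j).c5 + S + c := fun j => rfl
  have hweak : ∀ j, (prm j).Weaker (prm' j) := fun j =>
    { δ_le := le_rfl, δreg_eq := rfl, δL_le := le_rfl, β_eq := rfl, κ_eq := rfl, M_le := le_rfl, Ccov_le := le_rfl,
      cE_le := by rw [hcE']; linarith
      slack_le := le_rfl
      cLF_le := by rw [hcLF']; exact hadm.largeField j
      c5_le := by rw [hc5']; linarith }
  refine ⟨prm', ?_, fun j => ⟨hweak j, (hcE' j).ge, ?_, fun K hK => ?_⟩⟩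
  · -- admissibility of the softened schedule: all clauses of `prm` except `vacuum`, `largeField`, `stability`, which shift by constants
    obtain ⟨C₀, hC₀⟩ := hadm.vacuum
    obtain ⟨C₅, hC₅⟩ := hadm.stability
    exact { window := hadm.window, regular := hadm.regular, largeThreshold := hadm.largeThreshold, beta := hadm.beta,
            decay := hadm.decay, diam := hadm.diam, cover := hadm.cover,
            vacuum := ⟨C₀ + S, fun j => by rw [hcE']; linarith [hC₀ j]⟩,
            slack := hadm.slack,
            largeField := fun j => by rw [hcLF'],
            stability := ⟨C₅ + S + c, fun j => by rw [hc5']; linarith [hC₅ j]⟩ }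
  · rw [hcLF']; positivity
  · rw [hcLF', hc5']
    have h1 := pFun_sq_div_four_le F hγ hγ1 hb₀ hp₀ j
    have h2 := pow_le_card_site F hK
    have hn : (0 : ℝ) ≤ Fintype.card (Site (F.P K) (K - j)) := Nat.cast_nonneg _
    have hn1 : (1 : ℝ) ≤ Fintype.card (Site (F.P K) (K - j)) := by exact_mod_cast Fintype.card_pos (α := Site (F.P K) (K - j))
    have h3 : B10.pFun b₀ p₀ (Real.sqrt (γ * ((F.L : ℝ)⁻¹) ^ j)) ^ 2 / 4 ≤ c * Fintype.card (Site (F.P K) (K - j)) :=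
      h1.trans (by rw [← hc]; exact mul_le_mul_of_nonneg_left h2 hc0)
    have h4 : S ≤ S * Fintype.card (Site (F.P K) (K - j)) := le_mul_of_one_le_right hS hn1
    nlinarith

end Schedule

/-! ## §4 The frame statement: every admissible frame admits softened members -/

/-- **THE ∃κ-MEMBERSHIP FRAME OF `BackwardStabilityAdmFR` IS CLOSED UNDER BOUNDED MULTIPLICATIVE PERTURBATIONS, UP TO SOFTENING THE SCHEDULE**:
for `0 < γ ≤ 1`, `0 ≤ b₀`, `0 < p₀`, `0 ≤ S` and every admissible `prm` there is an admissible `prm'` such that at EVERY height `j`, if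
`e^{κ}·ρ` is a height-`j` member for `prm j` then `e^{κ}·(ρ·e^{p})` is a height-`j` member for `prm' j`, for every measurable gauge-invariant
`p` with `|p| ≤ S` (averaging of record `ℰp`, group `SU(2)`; any `ℰ`, `G` in §1–§2).  READING: the typed class sees bounded multiplicative
perturbations only through `O(S)` shifts of two existential constants; what protects the crux from such perturbations of a class tower is its
κ-clustered four-point clause, not membership. [cite: Balaban1985UV3, (5) p.256, (41)-(47) pp.266-267, (65)-(71) p.273] -/
theorem admFR_frame_soft (F : T3Family) {γ b₀ p₀ : ℝ} (hγ : 0 < γ) (hγ1 : γ ≤ 1) (hb₀ : 0 ≤ b₀) (hp₀ : 0 < p₀) {prm : ℕ → ClassParams}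
    (hadm : AdmissibleClassParams F γ b₀ p₀ prm) {S : ℝ} (hS : 0 ≤ S) :
    ∃ prm' : ℕ → ClassParams, AdmissibleClassParams F γ b₀ p₀ prm' ∧ (∀ j, (prm j).Weaker (prm' j)) ∧
      ∀ (j : ℕ) (κ : ℝ) (ρ p : GaugeField (F.P j) 0 (Matrix.specialUnitaryGroup (Fin 2) ℂ) → ℝ),
        Measurable p → GaugeField.GaugeInvariant p → (∀ V, |p V| ≤ S) →
        MemAtHeight F T3UnitLawDensityEML.ℰp j (prm j) (fun V => Real.exp κ * ρ V) →
        MemAtHeight F T3UnitLawDensityEML.ℰp j (prm' j) (fun V => Real.exp κ * (ρ V * Real.exp (p V))) := by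
  obtain ⟨prm', hadm', hj⟩ := exists_admissible_soft F hγ hγ1 hb₀ hp₀ hadm hS
  refine ⟨prm', hadm', fun j => (hj j).1, fun j κ ρ p hpm hpg hp hmem => ?_⟩
  obtain ⟨hw, hcE, hcLF, hc5⟩ := hj j
  have key := memAtHeight_mul_exp F hmem hw hS hp hpm hpg hcE hcLF hc5
  have hfun : (fun V => Real.exp κ * ρ V * Real.exp (p V)) = fun V => Real.exp κ * (ρ V * Real.exp (p V)) := by
    funext V; ring
  rw [← hfun]
  exact key

end Summit.QuantumFields.YangMills.Theorems.AdmFRFrameSoftPerturbation
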